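import Literature.Combinatorics.Enumerative.EulerPentagonalPowerSeries
import Mathlib.Analysis.SpecialFunctions.Log.Summable
import Mathlib.Analysis.SpecificLimits.Normed
import Mathlib.Topology.Algebra.InfiniteSum.NatInt

/-!
# Euler's pentagonal number theorem as an analytic identity (Hardy–Wright Theorem 353, `|x| < 1`)

Hardy–Wright, *An Introduction to the Theory of Numbers*, §19.9, Theorem 353 (Euler):

> `(1 − x)(1 − x²)(1 − x³)… = Σ_{−∞}^{∞} (−1)ⁿ x^{½n(3n+1)}`,

i.e. (19.9.3) `= 1 + Σ_{n≥1} (−1)ⁿ {x^{½n(3n−1)} + x^{½n(3n+1)}} = 1 − x − x² + x⁵ + x⁷ − x¹² − x¹⁵ + ⋯`,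
an identity between a convergent infinite product and an absolutely convergent series for
`|x| < 1` (§19.3: «the series and products with which we deal are all absolutely convergent … for
`|x| < 1`»; §19.9 is one of the two places where Hardy–Wright say the limit process «is less
obvious» and must be attended to).

The tree has Theorem 353 as an identity of formal power series
(`EulerPentagonalPowerSeries`: `hasSum_pentagonal`, via Shanks' finite identity). Here it is proved
**as printed, at a point**: for `x` in a complete normed field `𝕜` with `‖x‖ < 1`. The proof is
Shanks' (*A short proof of an identity of Euler*, Proc. AMS 2 (1951) 747–749): his finite identity
(the tree's `shanks_identity`, valid in any commutative ring)
`Σ_{s=0}^{n} (−1)ˢ (Pₙ/Pₛ) x^{sn + s(s+1)/2} = 1 + Σ_{s=1}^{n} (−1)ˢ [x^{s(3s−1)/2} + x^{s(3s+1)/2}] =: Sₙ`,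
`Pₙ = (1 − x)⋯(1 − xⁿ)`, has first term (`s = 0`) `Pₙ`, and the remaining terms are
`O(n · exp(|x|/(1−|x|)) · |x|ⁿ) → 0` («since the remaining terms of `Fₙ` are of order `x^{n+1}` and
higher»), while `Pₙ → ∏ (1 − xⁿ)` and `Sₙ →` the pentagonal series.

## Main statements (`‖x‖ < 1`)

* `multipliable_one_sub_pow_succ`, `tendsto_prod_range_one_sub_pow_succ` — `Pₙ → ∏_{n≥1} (1 − xⁿ)`;
* `norm_shanks_sub_prod_le` — `‖Fₙ − Pₙ‖ ≤ n · e^{‖x‖/(1−‖x‖)} · ‖x‖ⁿ`;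
* `hasSum_pentagonal_nat` — **(19.9.3)**:
  `Σ_{m≥0} (−1)^{m+1} (x^{(m+1)(3m+2)/2} + x^{(m+1)(3m+4)/2}) = ∏_{n≥1} (1 − xⁿ) − 1`;
* `tprod_one_sub_pow_succ_eq_one_add_tsum` — the same as an equation;
* `hasSum_pentagonal_int` — **Theorem 353** with the bilateral sum over `ℤ`
  (Mathlib's `pentagonal k = k(3k−1)/2`, `Int.negOnePow`):
  `Σ_{k∈ℤ} (−1)ᵏ x^{pentagonal k} = ∏_{n≥1} (1 − xⁿ)`, and `tprod_one_sub_pow_succ_eq_tsum_int`.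

## References
* [HardyWright2008] G. H. Hardy, E. M. Wright, *An Introduction to the Theory of Numbers*, 6th ed.
  (OUP 2008), §19.9 Theorem 353, (19.9.3).
* [Shanks1951] D. Shanks, *A short proof of an identity of Euler*, Proc. Amer. Math. Soc. 2 (1951)
  747–749 (the finite identity (2) and the limit `n → ∞`).
-/

noncomputable section

open Finset Filter Topology
open Literature.Combinatorics.Enumerative.EulerPentagonal

namespace Literature.Combinatorics.Enumerative.EulerPentagonalAnalytic

variable {𝕜 : Type*} [NormedField 𝕜] [CompleteSpace 𝕜]

/-! ### §1. The product `Pₙ → ∏ (1 − xⁿ)` -/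

/-- `∏_{n≥1} (1 − xⁿ)` converges for `‖x‖ < 1` (`Σ ‖x‖ⁿ < ∞`). [cite: HardyWright2008, §19.9 Thm 353] -/
theorem multipliable_one_sub_pow_succ {x : 𝕜} (hx : ‖x‖ < 1) :
    Multipliable fun k ↦ (1 : 𝕜) - x ^ (k + 1) := by
  simp_rw [sub_eq_add_neg]
  apply multipliable_one_add_of_summable
  simp_rw [norm_neg, norm_pow, pow_succ]
  exact (summable_geometric_of_lt_one (norm_nonneg x) hx).mul_right ‖x‖

/-- `Pₙ = (1 − x)(1 − x²)⋯(1 − xⁿ) → ∏_{n≥1} (1 − xⁿ)` for `‖x‖ < 1`.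
[cite: HardyWright2008, §19.9 Thm 353] -/
theorem tendsto_prod_range_one_sub_pow_succ {x : 𝕜} (hx : ‖x‖ < 1) :
    Tendsto (fun n ↦ ∏ k ∈ range n, ((1 : 𝕜) - x ^ (k + 1))) atTop
      (𝓝 (∏' k, ((1 : 𝕜) - x ^ (k + 1)))) :=
  (multipliable_one_sub_pow_succ hx).hasProd.tendsto_prod_nat

/-! ### §2. Shanks' remainder terms are `O(n |x|ⁿ)` -/

omit [CompleteSpace 𝕜] in
/-- A geometric tail: `Σ_{i ∈ S} ‖x‖^{i+1} ≤ ‖x‖/(1 − ‖x‖)` for every finite `S`. [folklore] -/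
private theorem sum_norm_pow_succ_le {x : 𝕜} (hx : ‖x‖ < 1) (S : Finset ℕ) :
    ∑ i ∈ S, ‖x‖ ^ (i + 1) ≤ ‖x‖ / (1 - ‖x‖) := by
  have hsum : Summable fun i : ℕ ↦ ‖x‖ ^ (i + 1) := by
    simp_rw [pow_succ]
    exact (summable_geometric_of_lt_one (norm_nonneg x) hx).mul_right ‖x‖
  have htsum : ∑' i : ℕ, ‖x‖ ^ (i + 1) = ‖x‖ / (1 - ‖x‖) := by
    simp_rw [pow_succ']
    rw [tsum_mul_left, tsum_geometric_of_lt_one (norm_nonneg x) hx, div_eq_mul_inv]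
  rw [← htsum]
  exact Summable.sum_le_tsum S (fun i _ ↦ by positivity) hsum

omit [CompleteSpace 𝕜] in
/-- **`|Pₙ/Pₛ| ≤ e^{|x|/(1−|x|)}`**: `‖(1 − x^{s+1})⋯(1 − xⁿ)‖ ≤ ∏ (1 + ‖x‖^{i+1}) ≤ exp Σ ‖x‖^{i+1}`.
[cite: Shanks1951, p. 748] -/
theorem norm_prod_Ico_one_sub_pow_le {x : 𝕜} (hx : ‖x‖ < 1) (s n : ℕ) :
    ‖∏ i ∈ Ico s n, ((1 : 𝕜) - x ^ (i + 1))‖ ≤ Real.exp (‖x‖ / (1 - ‖x‖)) := by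
  rw [norm_prod]
  calc ∏ i ∈ Ico s n, ‖(1 : 𝕜) - x ^ (i + 1)‖
      ≤ ∏ i ∈ Ico s n, Real.exp (‖x‖ ^ (i + 1)) := by
        refine Finset.prod_le_prod (fun i _ ↦ norm_nonneg _) fun i _ ↦ ?_
        calc ‖(1 : 𝕜) - x ^ (i + 1)‖ ≤ ‖(1 : 𝕜)‖ + ‖x ^ (i + 1)‖ := norm_sub_le _ _
          _ = ‖x‖ ^ (i + 1) + 1 := by rw [norm_one, norm_pow, add_comm]
          _ ≤ Real.exp (‖x‖ ^ (i + 1)) := Real.add_one_le_exp _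
    _ = Real.exp (∑ i ∈ Ico s n, ‖x‖ ^ (i + 1)) := (Real.exp_sum _ _).symm
    _ ≤ Real.exp (‖x‖ / (1 - ‖x‖)) := Real.exp_le_exp.mpr (sum_norm_pow_succ_le hx _)

omit [CompleteSpace 𝕜] in
/-- **«the remaining terms of `Fₙ` are of order `x^{n+1}` and higher»**: the terms `s = 1, …, n` of
Shanks' `Fₙ = Σ_{s=0}^{n} (−1)ˢ (Pₙ/Pₛ) x^{sn + s(s+1)/2}` have total norm at most
`n · e^{‖x‖/(1−‖x‖)} · ‖x‖ⁿ`, so `Fₙ − Pₙ → 0` for `‖x‖ < 1`. [cite: Shanks1951, p. 748] -/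
theorem norm_shanks_sub_prod_le {x : 𝕜} (hx : ‖x‖ < 1) (n : ℕ) :
    ‖(∑ s ∈ range (n + 1), (-1) ^ s * (∏ i ∈ Ico s n, ((1 : 𝕜) - x ^ (i + 1))) *
        x ^ (s * n + s * (s + 1) / 2)) - ∏ i ∈ range n, ((1 : 𝕜) - x ^ (i + 1))‖ ≤
      n * (Real.exp (‖x‖ / (1 - ‖x‖)) * ‖x‖ ^ n) := by
  rw [Finset.sum_range_succ']
  simp only [pow_zero, one_mul, zero_mul, Nat.zero_div, add_zero, mul_one, Finset.range_eq_Ico,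
    add_sub_cancel_right]
  rw [← Finset.range_eq_Ico]
  calc ‖∑ s ∈ range n, (-1) ^ (s + 1) * (∏ i ∈ Ico (s + 1) n, ((1 : 𝕜) - x ^ (i + 1))) *
          x ^ ((s + 1) * n + (s + 1) * (s + 1 + 1) / 2)‖
      ≤ ∑ s ∈ range n, ‖(-1) ^ (s + 1) * (∏ i ∈ Ico (s + 1) n, ((1 : 𝕜) - x ^ (i + 1))) *
          x ^ ((s + 1) * n + (s + 1) * (s + 1 + 1) / 2)‖ := norm_sum_le _ _
    _ ≤ ∑ s ∈ range n, Real.exp (‖x‖ / (1 - ‖x‖)) * ‖x‖ ^ n := by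
        refine Finset.sum_le_sum fun s _ ↦ ?_
        rw [norm_mul, norm_mul, norm_pow, norm_neg, norm_one, one_pow, one_mul, norm_pow]
        refine mul_le_mul (norm_prod_Ico_one_sub_pow_le hx _ _) ?_ (by positivity)
          (Real.exp_nonneg _)
        exact pow_le_pow_of_le_one (norm_nonneg x) hx.le
          ((Nat.le_mul_of_pos_left n (Nat.succ_pos s)).trans (Nat.le_add_right _ _))
    _ = n * (Real.exp (‖x‖ / (1 - ‖x‖)) * ‖x‖ ^ n) := by
        rw [Finset.sum_const, card_range, nsmul_eq_mul]

omit [CompleteSpace 𝕜] in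
/-- `Fₙ − Pₙ → 0` (`n |x|ⁿ → 0`). [cite: Shanks1951, p. 748] -/
theorem tendsto_shanks_sub_prod {x : 𝕜} (hx : ‖x‖ < 1) :
    Tendsto (fun n ↦ (∑ s ∈ range (n + 1), (-1) ^ s * (∏ i ∈ Ico s n, ((1 : 𝕜) - x ^ (i + 1))) *
        x ^ (s * n + s * (s + 1) / 2)) - ∏ i ∈ range n, ((1 : 𝕜) - x ^ (i + 1))) atTop (𝓝 0) := by
  refine squeeze_zero_norm (fun n ↦ norm_shanks_sub_prod_le hx n) ?_
  have h := (tendsto_self_mul_const_pow_of_lt_one (norm_nonneg x) hx).const_mul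
    (Real.exp (‖x‖ / (1 - ‖x‖)))
  rw [mul_zero] at h
  refine h.congr fun n ↦ ?_
  ring

/-! ### §3. Theorem 353 at a point -/

omit [CompleteSpace 𝕜] in
/-- The exponents `½(m+1)(3m+2)`, `½(m+1)(3m+4)` are at least `m + 1`, so the terms of the
pentagonal series are bounded by `2‖x‖^{m+1}`. [folklore] -/
private theorem norm_pentagonal_term_le {x : 𝕜} (hx : ‖x‖ < 1) (m : ℕ) :
    ‖(-1 : 𝕜) ^ (m + 1) * (x ^ ((m + 1) * (3 * (m + 1) - 1) / 2) +
        x ^ ((m + 1) * (3 * (m + 1) + 1) / 2))‖ ≤ 2 * ‖x‖ ^ (m + 1) := by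
  rw [norm_mul, norm_pow, norm_neg, norm_one, one_pow, one_mul]
  have h1 : m + 1 ≤ (m + 1) * (3 * (m + 1) - 1) / 2 := by
    apply (Nat.le_div_iff_mul_le two_pos).mpr
    calc (m + 1) * 2 ≤ (m + 1) * (3 * (m + 1) - 1) := Nat.mul_le_mul_left _ (by omega)
      _ = _ := rfl
  have h2 : m + 1 ≤ (m + 1) * (3 * (m + 1) + 1) / 2 := by
    apply (Nat.le_div_iff_mul_le two_pos).mpr
    exact Nat.mul_le_mul_left _ (by omega)
  calc ‖x ^ ((m + 1) * (3 * (m + 1) - 1) / 2) + x ^ ((m + 1) * (3 * (m + 1) + 1) / 2)‖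
      ≤ ‖x ^ ((m + 1) * (3 * (m + 1) - 1) / 2)‖ + ‖x ^ ((m + 1) * (3 * (m + 1) + 1) / 2)‖ :=
        norm_add_le _ _
    _ ≤ ‖x‖ ^ (m + 1) + ‖x‖ ^ (m + 1) := by
        rw [norm_pow, norm_pow]
        exact add_le_add (pow_le_pow_of_le_one (norm_nonneg x) hx.le h1)
          (pow_le_pow_of_le_one (norm_nonneg x) hx.le h2)
    _ = 2 * ‖x‖ ^ (m + 1) := by ring

/-- The pentagonal series converges absolutely for `‖x‖ < 1`. [cite: HardyWright2008, §19.9 (19.9.3)] -/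
theorem summable_pentagonal_nat {x : 𝕜} (hx : ‖x‖ < 1) :
    Summable fun m : ℕ ↦ (-1 : 𝕜) ^ (m + 1) *
      (x ^ ((m + 1) * (3 * (m + 1) - 1) / 2) + x ^ ((m + 1) * (3 * (m + 1) + 1) / 2)) := by
  refine .of_norm_bounded (g := fun m ↦ 2 * ‖x‖ ^ (m + 1)) ?_ (norm_pentagonal_term_le hx)
  simp_rw [pow_succ']
  simpa [mul_assoc] using ((summable_geometric_of_lt_one (norm_nonneg x) hx).mul_left (2 * ‖x‖))

/-- **Hardy–Wright (19.9.3) at a point** (Euler's pentagonal number theorem, folded form): for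
`‖x‖ < 1`,
`Σ_{m≥0} (−1)^{m+1} (x^{½(m+1)(3m+2)} + x^{½(m+1)(3m+4)}) = ∏_{n≥1} (1 − xⁿ) − 1`, i.e.
`(1 − x)(1 − x²)(1 − x³)… = 1 − x − x² + x⁵ + x⁷ − x¹² − x¹⁵ + ⋯` (by Shanks' finite identity and
`n → ∞`). [cite: HardyWright2008, §19.9 Thm 353] -/
theorem hasSum_pentagonal_nat {x : 𝕜} (hx : ‖x‖ < 1) :
    HasSum (fun m : ℕ ↦ (-1 : 𝕜) ^ (m + 1) *
        (x ^ ((m + 1) * (3 * (m + 1) - 1) / 2) + x ^ ((m + 1) * (3 * (m + 1) + 1) / 2)))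
      ((∏' k, ((1 : 𝕜) - x ^ (k + 1))) - 1) := by
  rw [(summable_pentagonal_nat hx).hasSum_iff_tendsto_nat]
  -- the partial sums are `Fₙ − 1 = Pₙ + (Fₙ − Pₙ) − 1`
  have hF : ∀ n, ∑ m ∈ range n, (-1 : 𝕜) ^ (m + 1) *
      (x ^ ((m + 1) * (3 * (m + 1) - 1) / 2) + x ^ ((m + 1) * (3 * (m + 1) + 1) / 2)) =
      (∏ i ∈ range n, ((1 : 𝕜) - x ^ (i + 1))) +
        ((∑ s ∈ range (n + 1), (-1) ^ s * (∏ i ∈ Ico s n, ((1 : 𝕜) - x ^ (i + 1))) *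
          x ^ (s * n + s * (s + 1) / 2)) - ∏ i ∈ range n, ((1 : 𝕜) - x ^ (i + 1))) - 1 := by
    intro n
    rw [shanks_identity x n]
    ring
  simp_rw [hF]
  have h := ((tendsto_prod_range_one_sub_pow_succ hx).add (tendsto_shanks_sub_prod hx)).sub
    (tendsto_const_nhds (x := (1 : 𝕜)))
  simpa using h

/-- **(19.9.3)** as an equation: `∏_{n≥1} (1 − xⁿ) = 1 + Σ_{m≥0} (−1)^{m+1} (x^{…} + x^{…})` for
`‖x‖ < 1`. [cite: HardyWright2008, §19.9 (19.9.3)] -/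
theorem tprod_one_sub_pow_succ_eq_one_add_tsum {x : 𝕜} (hx : ‖x‖ < 1) :
    ∏' k, ((1 : 𝕜) - x ^ (k + 1)) = 1 + ∑' m : ℕ, (-1 : 𝕜) ^ (m + 1) *
      (x ^ ((m + 1) * (3 * (m + 1) - 1) / 2) + x ^ ((m + 1) * (3 * (m + 1) + 1) / 2)) := by
  rw [(hasSum_pentagonal_nat hx).tsum_eq]
  ring

omit [CompleteSpace 𝕜] in
/-- `|k| ≤ pentagonal k`, so the `k`-th term of the bilateral series has norm `≤ ‖x‖^{|k|}`.
[folklore] -/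
private theorem norm_negOnePow_mul_pow_pentagonal_le {x : 𝕜} (hx : ‖x‖ < 1) (k : ℤ) :
    ‖((k.negOnePow : ℤ) : 𝕜) * x ^ pentagonal k‖ ≤ ‖x‖ ^ k.natAbs := by
  have hk : k.natAbs ≤ pentagonal k := by
    obtain ⟨m, rfl | rfl⟩ := Int.eq_nat_or_neg k
    · rw [Int.natAbs_natCast, pentagonal_natCast]
      rcases m.eq_zero_or_pos with rfl | hm
      · simp
      · apply (Nat.le_div_iff_mul_le two_pos).mpr
        calc m * 2 ≤ m * (3 * m - 1) := Nat.mul_le_mul_left _ (by omega)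
          _ = _ := rfl
    · rw [Int.natAbs_neg, Int.natAbs_natCast, pentagonal_neg_natCast]
      rcases m.eq_zero_or_pos with rfl | hm
      · simp
      · apply (Nat.le_div_iff_mul_le two_pos).mpr
        exact Nat.mul_le_mul_left m (show 2 ≤ 3 * m + 1 by omega)
  rw [norm_mul, norm_pow]
  have h1 : ‖((k.negOnePow : ℤ) : 𝕜)‖ = 1 := by
    rcases Int.units_eq_one_or k.negOnePow with h | h <;> simp [h]
  rw [h1, one_mul]
  exact pow_le_pow_of_le_one (norm_nonneg x) hx.le hk

/-- **Hardy–Wright Theorem 353 (Euler) at a point**, bilateral form: for `‖x‖ < 1`,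
`Σ_{k∈ℤ} (−1)ᵏ x^{k(3k−1)/2} = (1 − x)(1 − x²)(1 − x³)…` (H&W print the exponent `½n(3n+1)`;
`n ↦ −n` permutes `ℤ`; `pentagonal` is Mathlib's generalised pentagonal number).
[cite: HardyWright2008, §19.9 Thm 353] -/
theorem hasSum_pentagonal_int {x : 𝕜} (hx : ‖x‖ < 1) :
    HasSum (fun k : ℤ ↦ ((k.negOnePow : ℤ) : 𝕜) * x ^ pentagonal k)
      (∏' k, ((1 : 𝕜) - x ^ (k + 1))) := by
  set f : ℤ → 𝕜 := fun k ↦ ((k.negOnePow : ℤ) : 𝕜) * x ^ pentagonal k with hf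
  -- the two halves `k = m + 1` and `k = −(m + 1)` converge absolutely
  have hgeo : Summable fun m : ℕ ↦ ‖x‖ ^ (m + 1) := by
    simp_rw [pow_succ]
    exact (summable_geometric_of_lt_one (norm_nonneg x) hx).mul_right ‖x‖
  have hpos : Summable fun m : ℕ ↦ f ((m : ℤ) + 1) := by
    refine .of_norm_bounded hgeo fun m ↦ ?_
    have h := norm_negOnePow_mul_pow_pentagonal_le hx ((m : ℤ) + 1)
    have e : ((m : ℤ) + 1).natAbs = m + 1 := by omega
    rwa [e] at h
  have hneg : Summable fun m : ℕ ↦ f (-((m : ℤ) + 1)) := by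
    refine .of_norm_bounded hgeo fun m ↦ ?_
    have h := norm_negOnePow_mul_pow_pentagonal_le hx (-((m : ℤ) + 1))
    have e : (-((m : ℤ) + 1)).natAbs = m + 1 := by omega
    rwa [e] at h
  have h := HasSum.of_add_one_of_neg_add_one hpos.hasSum hneg.hasSum
  -- identify the two halves with the folded series (19.9.3)
  have hpair : ∀ m : ℕ, f ((m : ℤ) + 1) + f (-((m : ℤ) + 1)) = (-1 : 𝕜) ^ (m + 1) *
      (x ^ ((m + 1) * (3 * (m + 1) - 1) / 2) + x ^ ((m + 1) * (3 * (m + 1) + 1) / 2)) := by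
    intro m
    have e1 : ((m : ℤ) + 1) = ((m + 1 : ℕ) : ℤ) := by push_cast; ring
    simp only [hf, e1, Int.negOnePow_neg, Int.coe_negOnePow_natCast, pentagonal_natCast,
      pentagonal_neg_natCast, Int.cast_pow, Int.cast_neg, Int.cast_one]
    ring
  have hsum : (∑' m : ℕ, f ((m : ℤ) + 1)) + ∑' m : ℕ, f (-((m : ℤ) + 1)) =
      (∏' k, ((1 : 𝕜) - x ^ (k + 1))) - 1 := by
    rw [← hpos.tsum_add hneg, ← (hasSum_pentagonal_nat hx).tsum_eq]
    exact tsum_congr hpair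
  have hp0 : pentagonal 0 = 0 := by simp [pentagonal]
  have h0 : f 0 = 1 := by simp [hf, hp0]
  convert h using 1
  rw [h0, add_assoc, add_comm (1 : 𝕜), ← add_assoc, hsum, sub_add_cancel]

/-- **Theorem 353** as an equation of product and bilateral sum, `‖x‖ < 1`.
[cite: HardyWright2008, §19.9 Thm 353] -/
theorem tprod_one_sub_pow_succ_eq_tsum_int {x : 𝕜} (hx : ‖x‖ < 1) :
    ∏' k, ((1 : 𝕜) - x ^ (k + 1)) = ∑' k : ℤ, ((k.negOnePow : ℤ) : 𝕜) * x ^ pentagonal k :=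
  (hasSum_pentagonal_int hx).tsum_eq.symm

end Literature.Combinatorics.Enumerative.EulerPentagonalAnalytic
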